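import Summits.SmoothPoincare4.SmoothPoincare4.Theses.VerlindeRLinks
import Summits.SmoothPoincare4.SmoothPoincare4.Theorems.VerlindeRLinksVrlComponentsHBallSlice
import Literature.Topology.FourManifolds.RLinkSphereExistence
import Literature.Topology.FourManifolds.RLinkSphereHomotopySphereProofs
import HarnessLib.Audit

/-!
# Negative lemmas for crux `VerlindeRLinks.VrlSlideGap` (stmt-SmoothPoincare4-16178):
# witness regimes — granted either partner crux, the slide gap IS a `1`-handle-free exotic `S⁴`

Crux-strategist redirect r1 (`planner-cstrat-stmt-SmoothPoincare4-16178-r1-0`, 2026-08-17), the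
kernel-checked half of `Cruxes/VrlSlideGap/STRATEGY-CENSUS-r1.md`.

The crux `VrlSlideGap` is the negation of the PRINTED Generalised Property R conjecture
(`slideGap_iff_not_gprc`, refuter r1): an `∃`-statement whose witnesses are R-links `L₀` that no
strict handle-slide sequence takes to a `0`-framed unlink.  The route reaches `¬ SmoothPoincare4`
from it only together with a PARTNER crux saying, in one typing or another, "a gap witness cannot
live on the standard sphere": the served partner `VrlSliceRigidity` (all components slice ⇒ slides
exist) or the re-glue partner S2 = `stub_stdSphereSlides` of line `sphere_split` of the sibling crux
(`Σ_L ≅ S⁴` ⇒ slides exist; `helper_closesAlt`).  This file records, over tree THEOREMS only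
(`VrlComponentsHBallSlice_proof`, the FGMW lemma
`Knot.exists_exotic_of_isHomotopyBallSlice_not_isSmoothlySlice_holds`, `exists_isRLinkSphere`,
`IsRLinkSphere.nonempty_homotopyEquiv_sphere_holds`), WHERE the witnesses of the crux can live:

* `not_spc4_of_component_not_slice` — an R-link with ONE component not smoothly slice in `B⁴` is
  already a counterexample to SPC4 (no slide clause, no invariant needed);
* `not_spc4_of_exotic_rLinkSphere` — an R-link one of whose closed manifolds `Σ_L`
  (`IsRLinkSphere X L`) is not diffeomorphic to `S⁴` is already a counterexample to SPC4;
* `gap_witness_regimes_slice` — `VrlSlideGap → (some R-link has a non-slice component) ∨ ¬ VrlSliceRigidity`: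
  every gap witness all of whose components are slice (GST's `L_{n,1}`, Meier–Zupan's generalized
  square knot links, every link read off a presentation of the STANDARD `S⁴`) refutes the served
  partner, and every other witness is by itself an exotic `S⁴`;
* `gap_witness_regimes_sphere` — `VrlSlideGap → (some R-link sphere is exotic) ∨ ¬ S2`: the same
  dichotomy for the re-glue partner;
* `gap_iff_exotic_rLinkSphere_of_stdSphereSlides` — GRANTED S2 and the in-print slide invariance of
  `Σ_L` (hypothesis `hSph`: strict slides to a `0`-framed unlink make every `Σ_L` standard; GST 2010
  §9, p. 19, "this would show that `W ≅ S⁴`"), the crux is EQUIVALENT to the existence of an R-link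
  with an exotic closed manifold, i.e. to the failure of SPC4 for homotopy spheres without
  `1`-handles (GST Prop. 9.2 read on the negative side) — a strict strengthening of `¬ SmoothPoincare4`.

Consequence (census r1): within this route the crux has no witness-producing line short of the
summit — a certificate on any standard-sphere pool closes the crux and breaks the route, a
certificate anywhere else is the exotic sphere itself; the crux's own content, `¬` printed GPRC,
is a frontier statement independent of SPC4 as far as the tree knows (27 + 9 cheap probes fail,
refuter r1 / strategist b1).  No definition, no named fact, no `sorry`; the one print fact used
(`hSph`) is an explicit hypothesis.

References: [GompfScharlemannThompson2010, §9 and Prop. 9.2, §7]; [FreedmanGompfMorrisonWalker2010,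
§2 Fact 2.1]; [Gompf1991Killing]; [MeierZupan2019GSK] (arXiv:1904.08527, Thm 1.1–1.2).
-/

noncomputable section

-- every `Summit.SmoothPoincare4.SmoothPoincare4.…` name repeats the summit = sub-problem segment
-- (D-0017 layout); the duplicate is deliberate.
set_option linter.dupNamespace false

namespace Summit.SmoothPoincare4.SmoothPoincare4.Theorems.VrlSlideGap.Negative.WitnessRegimes

open scoped Manifold ContDiff Topology
open Set Function Literature.Topology.FourManifolds
open Summit.SmoothPoincare4.SmoothPoincare4.Theses.VerlindeRLinks
  (VrlSlideGap VrlSliceRigidity VrlComponentsHBallSlice)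
open Summit.SmoothPoincare4.SmoothPoincare4.Theorems.VrlComponentsHBallSlice.KirbyLemma21
  (VrlComponentsHBallSlice_proof)

/-- Local notation: `𝔼 n` is the model Euclidean space `EuclideanSpace ℝ (Fin n)`. -/
local notation "𝔼 " n:arg => EuclideanSpace ℝ (Fin n)

/-- Local notation: `𝕊 n` is the unit sphere in `EuclideanSpace ℝ (Fin (n + 1))`. -/
local notation "𝕊 " n:arg => (Metric.sphere (0 : EuclideanSpace ℝ (Fin (n + 1))) 1)

/-! ### §1  The two summit-side regimes (theorems, no partner crux) -/

/-- **An R-link with a non-slice component is a counterexample to SPC4.**  If `Y ≅ #ⁿ(S² × S¹)` is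
integral surgery on `L` and the component `L_i` is not smoothly slice in `B⁴`, then some closed
smooth `M ≃ₕ S⁴` is not diffeomorphic to `S⁴`: `L_i` is slice in a homotopy `4`-ball (the proved
item `VrlComponentsHBallSlice_proof`, GST Prop. 2.3) and FGMW's lemma
(`Knot.exists_exotic_of_isHomotopyBallSlice_not_isSmoothlySlice_holds`) turns the pair into an
exotic sphere.  This is the route's `closes` with the slide gap and the partner crux REMOVED: the
summit content of a gap witness in this regime owes nothing to the no-slide clause.
[cite: FreedmanGompfMorrisonWalker2010, §2 Fact 2.1; GompfScharlemannThompson2010, Prop. 2.3] -/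
theorem not_spc4_of_component_not_slice [Knot.TubularNbhd.SmoothnessFacts] {n : ℕ}
    (L : FramedLink (Fin n)) (Y : Type) [TopologicalSpace Y] [T2Space Y]
    [SecondCountableTopology Y] [ChartedSpace (𝔼 3) Y] [IsManifold (𝓡 3) ∞ Y] [CompactSpace Y]
    [ConnectedSpace Y] (hY : IsSphereTwoProdCircleSum n Y) (hL : L.IsSurgery (𝓡 3) Y) (i : Fin n)
    (hi : ¬ (L.component i).IsSmoothlySlice) : ¬ SmoothPoincare4 := by
  intro hS
  obtain ⟨M, _, _, _, _, _, _, ⟨e⟩, hE⟩ :=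
    Knot.exists_exotic_of_isHomotopyBallSlice_not_isSmoothlySlice_holds
      ⟨L.component i, VrlComponentsHBallSlice_proof n L Y hY hL i, hi⟩
  obtain ⟨d⟩ := hS M ‹_› ‹_› e
  exact hE.false d

/-- **An R-link with an exotic closed manifold is a counterexample to SPC4.**  If some closed
manifold `X` of the framed link `L` (`IsRLinkSphere X L`: `0h ∪ (2-handles along L) ∪ n·3h ∪ 4h`)
is not diffeomorphic to `S⁴`, then SPC4 fails — `X` is compact and `≃ₕ S⁴`
(`IsRLinkSphere.nonempty_homotopyEquiv_sphere_holds`, GST §9).  No surgery hypothesis is needed.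
[cite: GompfScharlemannThompson2010, §9 and proof of Prop. 9.2] -/
theorem not_spc4_of_exotic_rLinkSphere {n : ℕ} (L : FramedLink (Fin n)) (X : Type)
    [TopologicalSpace X] [T2Space X] [SecondCountableTopology X] [ChartedSpace (𝔼 4) X]
    [IsManifold (𝓡 4) ∞ X] (hX : IsRLinkSphere X L) (hne : IsEmpty (X ≃ₘ⟮𝓡 4, 𝓡 4⟯ 𝕊 4)) :
    ¬ SmoothPoincare4 := by
  intro hS
  obtain ⟨e⟩ := IsRLinkSphere.nonempty_homotopyEquiv_sphere_holds n L X hX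
  obtain ⟨d⟩ := hS X ‹_› ‹_› e
  exact hne.false d

/-! ### §2  Where a gap witness can live, relative to the served partner `VrlSliceRigidity` -/

/-- **Witness regimes, slice form.**  Every witness of the crux either has a component that is not
smoothly slice — and is then by itself an exotic `S⁴` (`not_spc4_of_component_not_slice`) — or
has all components slice and then REFUTES the served partner crux `VrlSliceRigidity`.  In
particular every certificate on a link with slice components (GST's `L_{n,1} = Q ⊔ Vₙ`, both
`K # (-K̄)`; every Meier–Zupan generalized-square-knot R-link; every R-link read off a handle
presentation of the standard `S⁴`) closes the crux and breaks the route.  Pure logic.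
[cite: GompfScharlemannThompson2010, §1 p. 2 and §7; MeierZupan2019GSK, Thm 1.2] -/
theorem gap_witness_regimes_slice (hgap : VrlSlideGap) :
    (∃ (_ : Knot.TubularNbhd.SmoothnessFacts) (n : ℕ) (L : FramedLink (Fin n)) (Y : Type)
        (_ : TopologicalSpace Y) (_ : T2Space Y) (_ : SecondCountableTopology Y)
        (_ : ChartedSpace (𝔼 3) Y) (_ : IsManifold (𝓡 3) ∞ Y) (_ : CompactSpace Y)
        (_ : ConnectedSpace Y), IsSphereTwoProdCircleSum n Y ∧ L.IsSurgery (𝓡 3) Y ∧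
          (∃ i : Fin n, ¬ (L.component i).IsSmoothlySlice) ∧
          ∀ U : FramedLink (Fin n), U.IsZeroFramedUnlink →
            ¬ IsStrictHandleSlideEquivalent ⟨n, L⟩ ⟨n, U⟩) ∨
      ¬ VrlSliceRigidity := by
  obtain ⟨iν, n, L, Y, i₁, i₂, i₃, i₄, i₅, i₆, i₇, hY, hL, hno⟩ := hgap
  by_cases hall : ∀ i : Fin n, (L.component i).IsSmoothlySlice
  · refine Or.inr fun hSR => ?_
    obtain ⟨U, hU, hLU⟩ := @hSR iν n L Y i₁ i₂ i₃ i₄ i₅ i₆ i₇ hY hL hall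
    exact hno U hU hLU
  · refine Or.inl ⟨iν, n, L, Y, i₁, i₂, i₃, i₄, i₅, i₆, i₇, hY, hL, ?_, hno⟩
    by_contra hcon
    exact hall fun i => Classical.byContradiction fun hi => hcon ⟨i, hi⟩

/-- **Granted the served partner, the crux is the non-slice regime** (and hence summit-side):
`VrlSliceRigidity → VrlSlideGap → ∃` an R-link with a component that is not smoothly slice, which
by `not_spc4_of_component_not_slice` is an exotic `S⁴` on its own.  So along `closes` the no-slide
clause of the crux is used for exactly one thing: to exclude, via the partner, that all components
are slice. [cite: GompfScharlemannThompson2010, Prop. 2.3 and §9] -/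
theorem exists_component_not_slice_of_sliceRigidity (hSR : VrlSliceRigidity) (hgap : VrlSlideGap) :
    ∃ (_ : Knot.TubularNbhd.SmoothnessFacts) (n : ℕ) (L : FramedLink (Fin n)) (Y : Type)
        (_ : TopologicalSpace Y) (_ : T2Space Y) (_ : SecondCountableTopology Y)
        (_ : ChartedSpace (𝔼 3) Y) (_ : IsManifold (𝓡 3) ∞ Y) (_ : CompactSpace Y)
        (_ : ConnectedSpace Y), IsSphereTwoProdCircleSum n Y ∧ L.IsSurgery (𝓡 3) Y ∧
          ∃ i : Fin n, ¬ (L.component i).IsSmoothlySlice := by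
  rcases gap_witness_regimes_slice hgap with h | h
  · obtain ⟨iν, n, L, Y, i₁, i₂, i₃, i₄, i₅, i₆, i₇, hY, hL, hi, -⟩ := h
    exact ⟨iν, n, L, Y, i₁, i₂, i₃, i₄, i₅, i₆, i₇, hY, hL, hi⟩
  · exact (h @hSR).elim

/-! ### §3  Where a gap witness can live, relative to the re-glue partner S2 (`stdSphereSlides`) -/

/-- **Witness regimes, sphere form.**  Every witness `L₀` of the crux has a closed manifold `X`
(`exists_isRLinkSphere`); either `X` is NOT diffeomorphic to `S⁴` — an exotic sphere by itself
(`not_spc4_of_exotic_rLinkSphere`) — or it is, and then `L₀` REFUTES the re-glue partner S2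
("every R-link with a standard closed manifold strictly slides to a `0`-framed unlink", verbatim
`stub_stdSphereSlides` of `Cruxes/VrlSliceRigidity/Lines/sphere_split.lean`).  GST's `L_{n,1}`
(closed manifold `S⁴`, Gompf 1991 / Meier–Zupan) are in the second regime.
[cite: GompfScharlemannThompson2010, §9 and Prop. 9.2; Gompf1991Killing] -/
theorem gap_witness_regimes_sphere (hgap : VrlSlideGap) :
    (∃ (n : ℕ) (L : FramedLink (Fin n)) (X : Type) (_ : TopologicalSpace X) (_ : T2Space X)
        (_ : SecondCountableTopology X) (_ : ChartedSpace (𝔼 4) X) (_ : IsManifold (𝓡 4) ∞ X),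
        IsRLinkSphere X L ∧ IsEmpty (X ≃ₘ⟮𝓡 4, 𝓡 4⟯ 𝕊 4)) ∨
      ¬ (∀ [Knot.TubularNbhd.SmoothnessFacts] (n : ℕ) (L : FramedLink (Fin n)) (Y : Type)
          [TopologicalSpace Y] [T2Space Y] [SecondCountableTopology Y]
          [ChartedSpace (𝔼 3) Y] [IsManifold (𝓡 3) ∞ Y] [CompactSpace Y] [ConnectedSpace Y],
          IsSphereTwoProdCircleSum n Y → L.IsSurgery (𝓡 3) Y →
            ∀ (X : Type) [TopologicalSpace X] [T2Space X] [SecondCountableTopology X]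
              [ChartedSpace (𝔼 4) X] [IsManifold (𝓡 4) ∞ X],
              IsRLinkSphere X L → Nonempty (X ≃ₘ⟮𝓡 4, 𝓡 4⟯ 𝕊 4) →
                ∃ U : FramedLink (Fin n),
                  U.IsZeroFramedUnlink ∧ IsStrictHandleSlideEquivalent ⟨n, L⟩ ⟨n, U⟩) := by
  obtain ⟨iν, n, L, Y, i₁, i₂, i₃, i₄, i₅, i₆, i₇, hY, hL, hno⟩ := hgap
  obtain ⟨X, _, _, _, _, _, hX⟩ := @exists_isRLinkSphere n L Y i₁ i₂ i₃ i₄ i₅ hY hL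
  by_cases hstd : Nonempty (X ≃ₘ⟮𝓡 4, 𝓡 4⟯ 𝕊 4)
  · refine Or.inr fun h2 => ?_
    obtain ⟨U, hU, hLU⟩ := @h2 iν n L Y i₁ i₂ i₃ i₄ i₅ i₆ i₇ hY hL X _ ‹_› ‹_› _ ‹_› hX hstd
    exact hno U hU hLU
  · exact Or.inl ⟨n, L, X, _, ‹_›, ‹_›, _, ‹_›, hX, not_nonempty_iff.mp hstd⟩

/-- **Granted the re-glue partner S2, the crux IS the existence of a `1`-handle-free exotic
`4`-sphere.**  Hypotheses: S2 (`stub_stdSphereSlides`, open) and the in-print slide invariance of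
the closed manifold, `hSph`: if an R-link strictly slides to a `0`-framed unlink then each of its
closed manifolds is diffeomorphic to `S⁴` (GST 2010 §9, p. 19: "If the `2`-handles attached along
`L` can be slid so that the attaching link is the unlink, this would show that `W ≅ S⁴`"; slides
are diffeomorphisms of the trace, Laudenbach–Poénaru re-glues the `1`-handlebody, and the `0`-framed
unlink presents `S⁴` — not yet a tree theorem, hence a hypothesis).  Conclusion:
`VrlSlideGap ↔ ∃` an R-link (with its surgery data) one of whose closed manifolds is not
diffeomorphic to `S⁴` — i.e. the crux is exactly "SPC4 fails for homotopy spheres without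
`1`-handles" (GST Prop. 9.2, negative side), a strict strengthening of the route's target
`¬ SmoothPoincare4` (`not_spc4_of_exotic_rLinkSphere`). [cite: GompfScharlemannThompson2010, Prop. 9.2 and §9 p. 19] -/
theorem gap_iff_exotic_rLinkSphere_of_stdSphereSlides
    (h2 : ∀ [Knot.TubularNbhd.SmoothnessFacts] (n : ℕ) (L : FramedLink (Fin n)) (Y : Type)
      [TopologicalSpace Y] [T2Space Y] [SecondCountableTopology Y]
      [ChartedSpace (𝔼 3) Y] [IsManifold (𝓡 3) ∞ Y] [CompactSpace Y] [ConnectedSpace Y],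
      IsSphereTwoProdCircleSum n Y → L.IsSurgery (𝓡 3) Y →
        ∀ (X : Type) [TopologicalSpace X] [T2Space X] [SecondCountableTopology X]
          [ChartedSpace (𝔼 4) X] [IsManifold (𝓡 4) ∞ X],
          IsRLinkSphere X L → Nonempty (X ≃ₘ⟮𝓡 4, 𝓡 4⟯ 𝕊 4) →
            ∃ U : FramedLink (Fin n),
              U.IsZeroFramedUnlink ∧ IsStrictHandleSlideEquivalent ⟨n, L⟩ ⟨n, U⟩)
    (hSph : ∀ [Knot.TubularNbhd.SmoothnessFacts] (n : ℕ) (L U : FramedLink (Fin n)),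
      U.IsZeroFramedUnlink → IsStrictHandleSlideEquivalent ⟨n, L⟩ ⟨n, U⟩ →
        ∀ (X : Type) [TopologicalSpace X] [T2Space X] [SecondCountableTopology X]
          [ChartedSpace (𝔼 4) X] [IsManifold (𝓡 4) ∞ X],
          IsRLinkSphere X L → Nonempty (X ≃ₘ⟮𝓡 4, 𝓡 4⟯ 𝕊 4)) :
    VrlSlideGap ↔
      ∃ (_ : Knot.TubularNbhd.SmoothnessFacts) (n : ℕ) (L : FramedLink (Fin n)) (Y : Type)
        (_ : TopologicalSpace Y) (_ : T2Space Y) (_ : SecondCountableTopology Y)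
        (_ : ChartedSpace (𝔼 3) Y) (_ : IsManifold (𝓡 3) ∞ Y) (_ : CompactSpace Y)
        (_ : ConnectedSpace Y), IsSphereTwoProdCircleSum n Y ∧ L.IsSurgery (𝓡 3) Y ∧
          ∃ (X : Type) (_ : TopologicalSpace X) (_ : T2Space X) (_ : SecondCountableTopology X)
            (_ : ChartedSpace (𝔼 4) X) (_ : IsManifold (𝓡 4) ∞ X),
            IsRLinkSphere X L ∧ IsEmpty (X ≃ₘ⟮𝓡 4, 𝓡 4⟯ 𝕊 4) := by
  constructor
  · rintro ⟨iν, n, L, Y, i₁, i₂, i₃, i₄, i₅, i₆, i₇, hY, hL, hno⟩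
    obtain ⟨X, _, _, _, _, _, hX⟩ := @exists_isRLinkSphere n L Y i₁ i₂ i₃ i₄ i₅ hY hL
    refine ⟨iν, n, L, Y, i₁, i₂, i₃, i₄, i₅, i₆, i₇, hY, hL, X, _, ‹_›, ‹_›, _, ‹_›, hX, ?_⟩
    refine not_nonempty_iff.mp fun hstd => ?_
    obtain ⟨U, hU, hLU⟩ := @h2 iν n L Y i₁ i₂ i₃ i₄ i₅ i₆ i₇ hY hL X _ ‹_› ‹_› _ ‹_› hX hstd
    exact hno U hU hLU
  · rintro ⟨iν, n, L, Y, i₁, i₂, i₃, i₄, i₅, i₆, i₇, hY, hL, X, j₁, j₂, j₃, j₄, j₅, hX, hne⟩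
    refine ⟨iν, n, L, Y, i₁, i₂, i₃, i₄, i₅, i₆, i₇, hY, hL, fun U hU hLU => ?_⟩
    exact hne.false (Classical.choice (@hSph iν n L U hU hLU X j₁ j₂ j₃ j₄ j₅ hX))

/-- **Corollary: granted S2 and `hSph`, the crux implies the summit target** — the re-glued route's
deciding theorem factors as `VrlSlideGap ⇒ (exotic R-link sphere) ⇒ ¬ SmoothPoincare4`, the second
arrow being a theorem (`not_spc4_of_exotic_rLinkSphere`).  Cf. `helper_closesAlt` (which needs no
`hSph`, only this direction). [cite: GompfScharlemannThompson2010, Prop. 9.2] -/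
theorem not_spc4_of_gap_of_stdSphereSlides
    (h2 : ∀ [Knot.TubularNbhd.SmoothnessFacts] (n : ℕ) (L : FramedLink (Fin n)) (Y : Type)
      [TopologicalSpace Y] [T2Space Y] [SecondCountableTopology Y]
      [ChartedSpace (𝔼 3) Y] [IsManifold (𝓡 3) ∞ Y] [CompactSpace Y] [ConnectedSpace Y],
      IsSphereTwoProdCircleSum n Y → L.IsSurgery (𝓡 3) Y →
        ∀ (X : Type) [TopologicalSpace X] [T2Space X] [SecondCountableTopology X]
          [ChartedSpace (𝔼 4) X] [IsManifold (𝓡 4) ∞ X],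
          IsRLinkSphere X L → Nonempty (X ≃ₘ⟮𝓡 4, 𝓡 4⟯ 𝕊 4) →
            ∃ U : FramedLink (Fin n),
              U.IsZeroFramedUnlink ∧ IsStrictHandleSlideEquivalent ⟨n, L⟩ ⟨n, U⟩)
    (hgap : VrlSlideGap) : ¬ SmoothPoincare4 := by
  rcases gap_witness_regimes_sphere hgap with ⟨n, L, X, _, _, _, _, _, hX, hne⟩ | h
  · exact not_spc4_of_exotic_rLinkSphere L X hX hne
  · exact (h @h2).elim

end Summit.SmoothPoincare4.SmoothPoincare4.Theorems.VrlSlideGap.Negative.WitnessRegimes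

end
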